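import Summits.QuantumFields.QCD.Theses.NestedDissectionSea
import Literature.MathematicalPhysics.QuantumLattice.WilsonPropagatorHeavyMass

/-!
# Route `NestedDissectionSea`, support item `SchurCellStep` (stmt-QuantumFields-11274)

**One nested-dissection step for a Dirichlet Wilson cell.** On the torus `(ℤ/N)⁴`, for every
`SU(3)` gauge field `U`, bare mass `μ` and open box of sides `s ≤ N` at corner `0`:

* (a) the children block `D_II` of the Dirichlet cell matrix `D_c` (rows and columns in the union
  of the sixteen children interiors) is block diagonal over the children, so
  `det D_II = ∏_ε det D_{child ε}` — no `r = 1` Wilson hop joins two different children: in a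
  direction `i` where two children differ, their coordinates lie in `{1, …, ⌊sᵢ/2⌋ − 1}` and
  `{⌊sᵢ/2⌋ + 1, …, sᵢ − 1}` respectively, at distance `≥ 2` and, since `sᵢ ≤ N`, never wrapping
  around the torus;
* (b) if `D_II` is invertible, `det D_c = det D_II · det (D_ΣΣ − D_ΣI D_II⁻¹ D_IΣ)` (Schur
  complement onto the internal separator; the tree's
  `Literature.MathematicalPhysics.QuantumLattice.det_eq_det_toBlock_mul_det_schur`, i.e. Mathlib's
  `Matrix.det_toBlock` + `Matrix.det_fromBlocks₁₁`).

The route states the item with `let`-bound copies `box / hc / hs / D / Dc / inner` of the tree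
vocabulary `wilsonBox / halfCorner / halfSides / wilsonDirac … / wilsonCell / childrenInterior`
(`Literature/MathematicalPhysics/QuantumLattice/WilsonCellSchur.lean`, bodies verbatim), so the
closing theorem `schurCellStep_proof` is the vocabulary-level statement
`det_childrenBlock_eq_prod` up to unfolding.

Ingredients: a generic block-diagonal determinant lemma (`det_eq_prod_det_toSquareBlock`, from
`Matrix.BlockTriangular.det_fintype` with a linear order on the block labels pulled back from
`Fintype.equivFin`), the one-dimensional `ZMod N` bookkeeping (`zmod_halves_apart`), the tree's
locality lemma for the Wilson–Dirac matrix
(`Literature.MathematicalPhysics.QuantumLattice.wilsonDirac_apply_eq_zero_of_far`: an entry vanishes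
unless the two sites coincide or differ by a unit shift) and a reindexing of each diagonal block to
the child's own Dirichlet cell matrix (`det_eq_prod_det_of_blocks`). Helpers live in the
sub-namespace `Summit.QuantumFields.QCD.Theorems.SchurCellStep`.

References: A. George, SIAM J. Numer. Anal. 10 (1973) 345 (nested dissection) [George1973];
M. Cè, L. Giusti, S. Schaefer, Phys. Rev. D 95 (2017) 034503, §2 and App. A [CeGiustiSchaefer2017].
-/

noncomputable section

namespace Summit.QuantumFields.QCD.Theorems

open Literature.MathematicalPhysics.QuantumLattice Literature.MathematicalPhysics.QuantumFieldTheory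
  Literature.Probability.LatticeModels

namespace SchurCellStep

/-! ### A block-diagonal determinant lemma -/

/-- If the entries of a square matrix vanish between indices carrying different block labels
`b i ≠ b j`, its determinant is the product over the labels of the determinants of the diagonal
blocks (two-sided `Matrix.BlockTriangular.det_fintype`, for any linear order on the labels).
[folklore] -/
theorem det_eq_prod_det_toSquareBlock {m κ R : Type*} [CommRing R] [Fintype m] [DecidableEq m]
    [Fintype κ] [DecidableEq κ] (M : Matrix m m R) (b : m → κ)
    (h : ∀ i j, b i ≠ b j → M i j = 0) :
    M.det = ∏ k, (M.toSquareBlock b k).det := by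
  letI : LinearOrder κ := LinearOrder.lift' (Fintype.equivFin κ) (Fintype.equivFin κ).injective
  have hM : M.BlockTriangular b := fun i j hij => h i j hij.ne'
  convert hM.det_fintype

/-- Block-diagonal determinant with the diagonal blocks presented on their own index types: if the
entries of `M` vanish between different block labels and each label class `{a // b a = k}` is
identified with a type `n k` on which `M` restricts to `B k`, then `det M = ∏ k, det (B k)`.
[folklore] -/
theorem det_eq_prod_det_of_blocks {m κ R : Type*} [CommRing R] [Fintype m] [DecidableEq m]
    [Fintype κ] [DecidableEq κ] (M : Matrix m m R) (b : m → κ)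
    (h : ∀ i j, b i ≠ b j → M i j = 0) {n : κ → Type*} [∀ k, Fintype (n k)]
    [∀ k, DecidableEq (n k)] (e : ∀ k, n k ≃ {a // b a = k}) (B : ∀ k, Matrix (n k) (n k) R)
    (hB : ∀ k i j, M (e k i) (e k j) = B k i j) :
    M.det = ∏ k, (B k).det := by
  rw [det_eq_prod_det_toSquareBlock M b h]
  refine Fintype.prod_congr _ _ fun k => ?_
  rw [← Matrix.det_submatrix_equiv_self (e k)]
  congr 1
  ext i j
  exact hB k i j

/-! ### One-dimensional bookkeeping on `ZMod N` -/

/-- Adding `1` on `ZMod N` either adds `1` to the representative or wraps `N − 1 ↦ 0`.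
[folklore] -/
theorem zmod_val_add_one_or_wrap {N : ℕ} [NeZero N] (a : ZMod N) :
    (a + 1).val = a.val + 1 ∨ ((a + 1).val = 0 ∧ a.val + 1 = N) := by
  have ha : a.val < N := a.val_lt
  rcases Nat.lt_or_ge 1 N with h1 | h1
  · rw [ZMod.val_add, ZMod.val_one_eq_one_mod, Nat.mod_eq_of_lt h1]
    rcases Nat.lt_or_ge (a.val + 1) N with h | h
    · exact Or.inl (Nat.mod_eq_of_lt h)
    · have hN : a.val + 1 = N := by omega
      exact Or.inr ⟨by rw [hN, Nat.mod_self], hN⟩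
  · have hN1 : N = 1 := by have := NeZero.ne N; omega
    subst hN1
    exact Or.inr ⟨by have := (a + 1).val_lt; omega, by omega⟩

/-- If `h + (b − h).val < N` then the representative of `b` is `h + (b − h).val` (no wrap).
[folklore] -/
theorem zmod_val_eq_add_val_sub {N : ℕ} [NeZero N] (b : ZMod N) (h : ℕ)
    (hlt : h + (b - (h : ZMod N)).val < N) : b.val = h + (b - (h : ZMod N)).val := by
  have hh : h < N := lt_of_le_of_lt (Nat.le_add_right _ _) hlt
  have e : b = (b - (h : ZMod N)) + (h : ZMod N) := (sub_add_cancel b _).symm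
  conv_lhs => rw [e]
  rw [ZMod.val_add, ZMod.val_natCast, Nat.mod_eq_of_lt hh, Nat.mod_eq_of_lt (by omega), add_comm]

/-- The lower half `{1, …, h − 1}` and the upper half `{h + 1, …, h + t − 1}` of a window of length
`h + t ≤ N` on the discrete circle `ℤ/N` are at distance `≥ 2`: a point `a` of the lower half and a
point `b` of the upper half are distinct and not neighbours (in either direction). [folklore] -/
theorem zmod_halves_apart {N : ℕ} [NeZero N] {a b : ZMod N} {h t : ℕ} (hN : h + t ≤ N)
    (ha0 : 0 < a.val) (ha : a.val < h) (hb0 : 0 < (b - (h : ZMod N)).val)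
    (hbt : (b - (h : ZMod N)).val < t) :
    a ≠ b ∧ b ≠ a + 1 ∧ a ≠ b + 1 := by
  have hbv : b.val = h + (b - (h : ZMod N)).val := zmod_val_eq_add_val_sub b h (by omega)
  refine ⟨?_, ?_, ?_⟩
  · rintro rfl
    omega
  · intro e
    have he := congrArg ZMod.val e
    rcases zmod_val_add_one_or_wrap a with h1 | ⟨h1, h2⟩ <;> omega
  · intro e
    have he := congrArg ZMod.val e
    rcases zmod_val_add_one_or_wrap b with h1 | ⟨h1, h2⟩ <;> omega

/-! ### Sites that are neither equal nor nearest neighbours -/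

/-- Two sites of the four-torus whose `i`-th coordinates are distinct and not neighbours are
distinct and not related by a unit shift in any direction. [folklore] -/
theorem site_ne_and_ne_shift {N : ℕ} {x y : TorusSite 4 N} {i : Fin 4}
    (h1 : x i ≠ y i) (h2 : y i ≠ x i + 1) (h3 : x i ≠ y i + 1) :
    x ≠ y ∧ (∀ ν, y ≠ Literature.MathematicalPhysics.QuantumFieldTheory.Site.shift x ν) ∧
      (∀ ν, x ≠ Literature.MathematicalPhysics.QuantumFieldTheory.Site.shift y ν) := by
  refine ⟨fun e => h1 (congrFun e i), fun ν e => ?_, fun ν e => ?_⟩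
  · have he := congrFun e i
    by_cases hν : i = ν
    · subst hν
      simp [Literature.MathematicalPhysics.QuantumFieldTheory.Site.shift] at he
      exact h2 he
    · simp [Literature.MathematicalPhysics.QuantumFieldTheory.Site.shift, hν] at he
      exact h1 he.symm
  · have he := congrFun e i
    by_cases hν : i = ν
    · subst hν
      simp [Literature.MathematicalPhysics.QuantumFieldTheory.Site.shift] at he
      exact h3 he
    · simp [Literature.MathematicalPhysics.QuantumFieldTheory.Site.shift, hν] at he
      exact h1 he

/-! ### Geometry of the sixteen children of the corner-`0` box -/

variable {N : ℕ} [NeZero N]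

/-- For sides `s ≤ N`, every child box of the corner-`0` box of sides `s` lies inside it.
[folklore] -/
theorem wilsonBox_zero_of_child {s : Fin 4 → ℕ} (hsN : ∀ i, s i ≤ N) {ε : Fin 4 → Bool}
    {p : TorusSite 4 N × Fin 3 × Fin 4} (hp : wilsonBox (halfCorner s ε) (halfSides s ε) p) :
    wilsonBox (0 : TorusSite 4 N) s p := by
  intro i
  have hi := hp i
  have hs := hsN i
  simp only [halfCorner, halfSides] at hi
  simp only [Pi.zero_apply, sub_zero]
  cases hε : ε i
  · simp only [hε, Bool.false_eq_true, ↓reduceIte, sub_zero] at hi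
    omega
  · simp only [hε, ↓reduceIte] at hi
    have hv := zmod_val_eq_add_val_sub (p.1 i) (s i / 2) (by omega)
    omega

/-- For sides `s ≤ N`, two DIFFERENT children of the corner-`0` box are separated: a point of one
and a point of the other have distinct sites which are not nearest neighbours on the torus (in a
direction where the children differ the coordinates are `≤ ⌊sᵢ/2⌋ − 1` and `≥ ⌊sᵢ/2⌋ + 1`, and
`sᵢ ≤ N` excludes wrap-around). [folklore] -/
theorem children_apart {s : Fin 4 → ℕ} (hsN : ∀ i, s i ≤ N) {ε ε' : Fin 4 → Bool} (hne : ε ≠ ε')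
    {p q : TorusSite 4 N × Fin 3 × Fin 4} (hp : wilsonBox (halfCorner s ε) (halfSides s ε) p)
    (hq : wilsonBox (halfCorner s ε') (halfSides s ε') q) :
    p.1 ≠ q.1 ∧ (∀ ν, q.1 ≠ Literature.MathematicalPhysics.QuantumFieldTheory.Site.shift p.1 ν) ∧
      (∀ ν, p.1 ≠ Literature.MathematicalPhysics.QuantumFieldTheory.Site.shift q.1 ν) := by
  obtain ⟨i, hi⟩ := Function.ne_iff.mp hne
  have hpi := hp i
  have hqi := hq i
  have hs := hsN i
  simp only [halfCorner, halfSides] at hpi hqi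
  cases hε : ε i <;> cases hε' : ε' i
  · exact absurd (hε.trans hε'.symm) hi
  · simp only [hε, hε', Bool.false_eq_true, ↓reduceIte, sub_zero] at hpi hqi
    obtain ⟨h1, h2, h3⟩ := zmod_halves_apart (a := p.1 i) (b := q.1 i) (h := s i / 2)
      (t := s i - s i / 2) (by omega) hpi.1 hpi.2 hqi.1 hqi.2
    exact site_ne_and_ne_shift h1 h2 h3
  · simp only [hε, hε', Bool.false_eq_true, ↓reduceIte, sub_zero] at hpi hqi
    obtain ⟨h1, h2, h3⟩ := zmod_halves_apart (a := q.1 i) (b := p.1 i) (h := s i / 2)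
      (t := s i - s i / 2) (by omega) hqi.1 hqi.2 hpi.1 hpi.2
    exact site_ne_and_ne_shift (fun e => h1 e.symm) h3 h2
  · exact absurd (hε.trans hε'.symm) hi

/-- For sides `s ≤ N`, the sixteen children of the corner-`0` box are pairwise disjoint: the child
containing a point is unique. [folklore] -/
theorem child_unique {s : Fin 4 → ℕ} (hsN : ∀ i, s i ≤ N) {ε ε' : Fin 4 → Bool}
    {p : TorusSite 4 N × Fin 3 × Fin 4} (hp : wilsonBox (halfCorner s ε) (halfSides s ε) p)
    (hp' : wilsonBox (halfCorner s ε') (halfSides s ε') p) : ε = ε' := by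
  by_contra hne
  exact (children_apart hsN hne hp hp').1 rfl

/-! ### Clause (a): the children block is block diagonal -/

/-- **Clause (a) of `SchurCellStep` in the tree's vocabulary**: for sides `s ≤ N`, the determinant
of the children block `D_II` of the Dirichlet cell matrix of the corner-`0` box is the product over
the sixteen children `ε` of the children's Dirichlet determinants (block diagonality: no `r = 1`
Wilson hop joins two different children; each diagonal block is the child's own Dirichlet cell
matrix up to reindexing). Cè–Giusti–Schaefer 2017, §2 (block structure of the Dirac matrix under
a domain decomposition). [cite: CeGiustiSchaefer2017, §2] -/
theorem det_childrenBlock_eq_prod (U : GaugeConfig 4 N ↥(Matrix.specialUnitaryGroup (Fin 3) ℂ))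
    (μ : ℝ) (s : Fin 4 → ℕ) (hsN : ∀ i, s i ≤ N) :
    (childrenBlock U μ s).det =
      ∏ ε : Fin 4 → Bool, (wilsonCell U μ (halfCorner s ε) (halfSides s ε)).det := by
  -- the block label of a children-interior index: the (unique) child containing it
  obtain ⟨b, hb⟩ : ∃ b : {a : {p // wilsonBox (0 : TorusSite 4 N) s p} // childrenInterior s a} →
      (Fin 4 → Bool), ∀ a, wilsonBox (halfCorner s (b a)) (halfSides s (b a)) a.1.1 :=
    ⟨fun a => Classical.choose a.2, fun a => Classical.choose_spec a.2⟩
  have hoff : ∀ a a' : {a : {p // wilsonBox (0 : TorusSite 4 N) s p} // childrenInterior s a},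
      b a ≠ b a' → childrenBlock U μ s a a' = 0 := fun a a' hne => by
    obtain ⟨h0, h1, h2⟩ := children_apart hsN hne (hb a) (hb a')
    show wilsonDirac (fundamentalRep (Fin 3)) U μ 1 a.1.1 a'.1.1 = 0
    exact wilsonDirac_apply_eq_zero_of_far (fundamentalRep (Fin 3)) U μ 1 h0 h1 h2
  refine det_eq_prod_det_of_blocks (childrenBlock U μ s) b hoff
    (n := fun ε => {p // wilsonBox (halfCorner s ε) (halfSides s ε) p})
    (fun ε =>
      -- reindex the label class of `ε` to the child's own box
      { toFun := fun p =>
          ⟨⟨⟨p.1, wilsonBox_zero_of_child hsN p.2⟩, ⟨ε, p.2⟩⟩, child_unique hsN (hb _) p.2⟩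
        invFun := fun a => ⟨a.1.1.1,
          (congrArg (fun δ => wilsonBox (halfCorner s δ) (halfSides s δ) a.1.1.1) a.2).mp (hb a.1)⟩
        left_inv := fun p => rfl
        right_inv := fun a => rfl })
    (fun ε => wilsonCell U μ (halfCorner s ε) (halfSides s ε)) fun ε p q => rfl

end SchurCellStep

/-! ### The route item -/

/-- **Route item `SchurCellStep` (stmt-QuantumFields-11274), proved**: on the torus of side `N`, for
every `SU(3)` field, bare mass and open box of sides `s ≤ N` at corner `0`, (a) the block of the
Dirichlet cell matrix on the union of the sixteen children interiors has determinant equal to the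
product of the children's Dirichlet determinants (`SchurCellStep.det_childrenBlock_eq_prod`), and
(b) if that
block is invertible, `det (cell) = det (children block) · det (Schur complement onto the internal
separator)` (`Literature.MathematicalPhysics.QuantumLattice.det_eq_det_toBlock_mul_det_schur`).
Nested dissection, George 1973; Cè–Giusti–Schaefer 2017, §2 and App. A.
[cite: CeGiustiSchaefer2017, §2 and App. A] -/
theorem schurCellStep_proof : Summit.QuantumFields.QCD.Theses.NestedDissectionSea.SchurCellStep := by
  intro N _ U μ s hsN
  exact ⟨SchurCellStep.det_childrenBlock_eq_prod U μ s hsN,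
    fun hU => det_eq_det_toBlock_mul_det_schur _ _ hU⟩

end Summit.QuantumFields.QCD.Theorems

end
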